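import Summits.QuantumAdvantage.QuantumAdvantage.Theorems.RingMinorLaw
import Summits.QuantumAdvantage.AdviceFreeQNC0.KernelFibrationMoves
import Summits.QuantumAdvantage.AdviceFreeQNC0.RingRotation
import HarnessLib

/-!
# RingDeck (decomp-qadv lens-2 g11; tree package 3/3 of node «MinorDial»): the DECK LAW — exact XOR-symmetrisation over `ℤ/3`
and the equivariant fold

`rel_xor3` (the answer sets are `𝔽₂`-affine: XOR of three valid answers is valid) · `perfect_trans` (shift-`k`/rotate-`c` with
`k + c ≡ 0 (mod n)` is a symmetry of the game, tree `RingSymmetry.rel_rot`) · `sym3` (XOR of the three deck translates: degree `6d`,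
`m`-EQUIVARIANT) · `losing_three_mul : m ∈ losing (6d) → 3m ∈ losing d` (`m ≥ 3`, via tree `notPerfect_eqv_mul`) · `losing_three_pow` ·
`allHard_iff_deckEquivariant`: «every `losing d` co-finite» (= `ExactnessDial.NoPerfectConst3`) iff the same for DECK-SYMMETRIC
strategies on `C_{3m}`; §2 the SYMMETRY DIAL: `symK`, `symK_equivariant` (`3k`-equivariant ↦ `k`-equivariant), `tower`, and
`allHard_iff_eqv j`: WLOG `ℤ/3ʲ`-symmetric on `C_{3ʲm}` for EVERY fixed `j` (degree `6ʲ·d`).  Supports items stmt-QuantumAdvantage-27380 / 27432.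
-/

set_option linter.dupNamespace false

namespace Summit.QuantumAdvantage.QuantumAdvantage.Theorems.RingMinor

open Finset
open Literature.Computability.QuantumComplexity Literature.Computability.QuantumComplexity.RingHLF
open Literature.Computability.MetaComplexity Literature.Computability.MetaComplexity.Smolensky
open Summit.QuantumAdvantage.AdviceFreeQNC0
open Summit.QuantumAdvantage.QuantumAdvantage.Theorems.RingPeriodFold

/-! ### §5 THE DECK LAW (second self-similarity, PROVED): XOR-symmetrisation over the deck `ℤ/3` and the equivariant fold —
hardness of `C_m` at degree `6d` gives hardness of `C_{3m}` at degree `d`. -/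

section deck
variable {n : ℕ}

/-- the odd class is rotation invariant. -/
theorem oddZeros_rot (k : ℕ) (x : Fin n → Bool) : OddZeros (rot k x) ↔ OddZeros x := by
  unfold OddZeros
  rw [show (univ.filter fun b : Fin n => rot k x b = false) = (univ.filter fun b : Fin n => x (RingSymmetry.shift n k b) = false)
    from rfl, RingSymmetry.card_filter_shift k (fun b => x b = false)]

/-- the XOR of THREE valid answers is a valid answer (the answer set of a pattern is an affine `𝔽₂`-space). -/
theorem rel_xor3 {x a b c : Fin n → Bool} (ha : RingHLF.Rel x a) (hb : RingHLF.Rel x b) (hc : RingHLF.Rel x c) :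
    RingHLF.Rel x (fun i => xor (xor (a i) (b i)) (c i)) := by
  intro v hv
  have h1 := ha v hv
  have h2 := hb v hv
  have h3 := hc v hv
  have hs : signBit x v < 2 := Nat.mod_lt _ (by norm_num)
  rw [Fib19.dot2_xor_right v (fun i => xor (a i) (b i)) c, Fib19.dot2_xor_right v a b, h1, h2, h3]
  omega

/-- the TRANSLATE of a strategy: output index shifted by `k`, input rotated by `c` (`k + c ≡ 0 (mod n)` makes it a symmetry
of the game). -/
def trans (k c : ℕ) (P : Fin n → CubeFn (ZMod 3) n) : Fin n → CubeFn (ZMod 3) n := fun b x => P (RingSymmetry.shift n k b) (rot c x)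

/-- Ring-game helper `trans_mem` (lens-2 law package; see the module docstring). -/
theorem trans_mem {D : ℕ} {P : Fin n → CubeFn (ZMod 3) n} (hP : ∀ b, P b ∈ lowDeg (ZMod 3) n D) (k c : ℕ) (b : Fin n) :
    trans k c P b ∈ lowDeg (ZMod 3) n D :=
  Smolensky.comp_mem_lowDeg_of_coord (rot c) (ind_rot_mem' c) (hP _)

/-- a game symmetry carries perfect strategies to perfect strategies. -/
theorem perfect_trans {k c : ℕ} (hkc : ∃ q, k + c = n * q) (P : Fin n → CubeFn (ZMod 3) n)
    (hperf : ∀ x : Fin n → Bool, OddZeros x → RingHLF.Rel x (fun b => decide (P b x = 1))) :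
    ∀ x : Fin n → Bool, OddZeros x → RingHLF.Rel x (fun b => decide (trans k c P b x = 1)) := by
  intro x hx
  obtain ⟨q, hq⟩ := hkc
  have h1 := hperf (rot c x) ((oddZeros_rot c x).2 hx)
  have h2 := (RingSymmetry.rel_rot k (rot c x) (fun b => decide (P b (rot c x) = 1))).2 h1
  rw [RingSymmetry.rot_rot, hq, RingSymmetry.rot_mul_self] at h2
  exact h2

/-- Ring-game helper `shift_n` (lens-2 law package; see the module docstring). -/
theorem shift_n (b : Fin n) : RingSymmetry.shift n n b = b :=
  Fin.ext (by simp only [RingSymmetry.shift, Nat.add_mod_right]; exact Nat.mod_eq_of_lt b.isLt)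

/-- Ring-game helper `rot_n` (lens-2 law package; see the module docstring). -/
theorem rot_n (x : Fin n → Bool) : rot n x = x := by
  simpa using RingSymmetry.rot_mul_self 1 x

/-- **THE DECK SYMMETRISATION** of a strategy on `C_{3m}`: `S_b = z_b ⊕ z⁽ᵐ⁾_b ⊕ z⁽²ᵐ⁾_b` as `{0,1}`-valued polynomials
(degree `≤ 6D`): perfect if `z` is, and `m`-EQUIVARIANT. -/
def sym3 (m : ℕ) (P : Fin (3 * m) → CubeFn (ZMod 3) (3 * m)) : Fin (3 * m) → CubeFn (ZMod 3) (3 * m) := fun b =>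
  bx (bx (sig (P b)) (sig (trans m (2 * m) P b))) (sig (trans (2 * m) m P b))

/-- Ring-game helper `sym3_mem` (lens-2 law package; see the module docstring). -/
theorem sym3_mem {m D : ℕ} {P : Fin (3 * m) → CubeFn (ZMod 3) (3 * m)} (hP : ∀ b, P b ∈ lowDeg (ZMod 3) (3 * m) D) (b : Fin (3 * m)) :
    sym3 m P b ∈ lowDeg (ZMod 3) (3 * m) (6 * D) := by
  have h := bx_mem (bx_mem (sig_mem (hP b)) (sig_mem (trans_mem hP m (2 * m) b))) (sig_mem (trans_mem hP (2 * m) m b))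
  rw [show D + D + (D + D) + (D + D) = 6 * D by ring] at h
  exact h

/-- Ring-game helper `sym3_out` (lens-2 law package; see the module docstring). -/
theorem sym3_out {m : ℕ} (P : Fin (3 * m) → CubeFn (ZMod 3) (3 * m)) (x : Fin (3 * m) → Bool) :
    (fun b => decide (sym3 m P b x = 1)) = fun b =>
      xor (xor (decide (P b x = 1)) (decide (trans m (2 * m) P b x = 1))) (decide (trans (2 * m) m P b x = 1)) := by
  funext b
  unfold sym3
  rw [sig_eq_bind, sig_eq_bind, sig_eq_bind, bx_bind, bx_bind, decide_bind_eq_one]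

/-- Ring-game helper `sym3_equivariant` (lens-2 law package; see the module docstring). -/
theorem sym3_equivariant {m : ℕ} (P : Fin (3 * m) → CubeFn (ZMod 3) (3 * m)) : sym3 m P ∈ equivariant m (3 * m) := by
  rw [mem_equivariant]
  intro b x
  have e1 : RingSymmetry.shift (3 * m) m (RingSymmetry.shift (3 * m) m b) = RingSymmetry.shift (3 * m) (2 * m) b := by
    rw [RingSymmetry.shift_shift, ← two_mul]
  have e2 : RingSymmetry.shift (3 * m) (2 * m) (RingSymmetry.shift (3 * m) m b) = b := by
    rw [RingSymmetry.shift_shift, show m + 2 * m = 3 * m by ring, shift_n]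
  have e3 : rot (2 * m) (rot m x) = x := by
    rw [RingSymmetry.rot_rot, show 2 * m + m = 3 * m by ring, rot_n]
  have e4 : rot m (rot m x) = rot (2 * m) x := by
    rw [RingSymmetry.rot_rot, ← two_mul]
  simp only [sym3, trans, bx, sig, Pi.add_apply, Pi.mul_apply, Pi.smul_apply, Pi.one_apply, smul_eq_mul, e1, e2, e3, e4]
  ring

/-- **DECK LAW (PROVED)**: `m ≥ 3`, `m ∈ losing (6d) → 3m ∈ losing d` — if every degree-`≤ 6d` strategy loses on the odd class of
`C_m`, every degree-`≤ d` strategy loses on the odd class of `C_{3m}` (symmetrise over the deck `ℤ/3`, fold to `C_m`). -/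
theorem losing_three_mul {m d : ℕ} (hm : 3 ≤ m) (h : m ∈ losing (6 * d)) : 3 * m ∈ losing d := by
  rw [mem_losing]
  intro P hP
  by_contra hcon
  push Not at hcon
  obtain ⟨x, hx, hn⟩ :=
    notPerfect_eqv_mul (m := 3) (d := m) (by decide) hm h (sym3 m P) (sym3_mem hP) (sym3_equivariant P)
  apply hn
  rw [sym3_out]
  exact rel_xor3 (hcon x hx) (perfect_trans ⟨1, by ring⟩ P hcon x hx) (perfect_trans ⟨1, by ring⟩ P hcon x hx)

/-- the deck law iterated: `m ∈ losing (6^k · d) → 3^k · m ∈ losing d`. -/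
theorem losing_three_pow {k : ℕ} : ∀ {m d : ℕ}, 3 ≤ m → m ∈ losing (6 ^ k * d) → 3 ^ k * m ∈ losing d := by
  induction k with
  | zero => intro m d _ h; simpa using h
  | succ k ih =>
    intro m d hm h
    have h' : 3 ^ k * m ∈ losing (6 * d) := ih hm (by rw [show 6 ^ k * (6 * d) = 6 ^ (k + 1) * d by ring]; exact h)
    have h3 : 3 ≤ 3 ^ k * m := le_trans hm (Nat.le_mul_of_pos_left m (Nat.pow_pos (by norm_num)))
    rw [show 3 ^ (k + 1) * m = 3 * (3 ^ k * m) by ring]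
    exact losing_three_mul h3 h'


/-- **EQUIV «WLOG DECK-SYMMETRIC»** (uses BOTH laws): «every `losing d` is co-finite» (= `ExactnessDial.NoPerfectConst3` verbatim) iff,
on the deck rings `C_{3m}`, every constant-degree strategy that COMMUTES with rotation by `m` loses on some odd-class pattern —
symmetrise (`sym3`, degree `× 6`) and return to all lengths by `allHard_iff_class` (deck lengths). -/
theorem allHard_iff_deckEquivariant :
    (∀ d : ℕ, ∃ n₀ : ℕ, ∀ n ≥ n₀, n ∈ losing d) ↔
    (∀ d : ℕ, ∃ m₀ : ℕ, ∀ m ≥ m₀, ∀ P : Fin (3 * m) → CubeFn (ZMod 3) (3 * m), (∀ b, P b ∈ lowDeg (ZMod 3) (3 * m) d) →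
      P ∈ equivariant m (3 * m) → ∃ x : Fin (3 * m) → Bool, OddZeros x ∧ ¬ RingHLF.Rel x (fun b => decide (P b x = 1))) := by
  constructor
  · intro hT d
    obtain ⟨n₀, h⟩ := hT d
    exact ⟨n₀, fun m hm P hP _ => (mem_losing d (3 * m)).1 (h (3 * m) (by omega)) P hP⟩
  · intro H
    rw [allHard_iff_class (q := 3) (by norm_num) 0]
    intro d
    obtain ⟨m₀, h⟩ := H (6 * d)
    refine ⟨3 * m₀, fun n hn hmod => ?_⟩
    obtain ⟨m, rfl⟩ : ∃ m, n = 3 * m := ⟨n / 3, by simp at hmod; omega⟩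
    rw [mem_losing]
    intro P hP
    by_contra hcon
    push Not at hcon
    obtain ⟨x, hx, hn'⟩ := h m (by omega) (sym3 m P) (sym3_mem hP) (sym3_equivariant P)
    apply hn'
    rw [sym3_out]
    exact rel_xor3 (hcon x hx) (perfect_trans ⟨1, by ring⟩ P hcon x hx) (perfect_trans ⟨1, by ring⟩ P hcon x hx)

/-! ### §2 THE SYMMETRY DIAL: one notch `symK` at any shift, the tower, and «WLOG `ℤ/3ʲ`-symmetric» for every constant `j` -/

/-- ONE NOTCH of symmetrisation at shift `k` on a ring of any length `n ≥ 2k`: `[P_b] ⊕ [P_{b+k} ∘ rot_{n-k}] ⊕ [P_{b+2k} ∘ rot_{n-2k}]`. -/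
def symK (k : ℕ) (P : Fin n → CubeFn (ZMod 3) n) : Fin n → CubeFn (ZMod 3) n := fun b =>
  bx (bx (sig (P b)) (sig (trans k (n - k) P b))) (sig (trans (2 * k) (n - 2 * k) P b))

/-- Ring-game helper `symK_mem` (lens-2 law package; see the module docstring). -/
theorem symK_mem {D : ℕ} {P : Fin n → CubeFn (ZMod 3) n} (hP : ∀ b, P b ∈ lowDeg (ZMod 3) n D) (k : ℕ) (b : Fin n) :
    symK k P b ∈ lowDeg (ZMod 3) n (6 * D) := by
  have h := bx_mem (bx_mem (sig_mem (hP b)) (sig_mem (trans_mem hP k (n - k) b))) (sig_mem (trans_mem hP (2 * k) (n - 2 * k) b))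
  rw [show D + D + (D + D) + (D + D) = 6 * D by ring] at h
  exact h

/-- Ring-game helper `symK_out` (lens-2 law package; see the module docstring). -/
theorem symK_out (k : ℕ) (P : Fin n → CubeFn (ZMod 3) n) (x : Fin n → Bool) :
    (fun b => decide (symK k P b x = 1)) = fun b =>
      xor (xor (decide (P b x = 1)) (decide (trans k (n - k) P b x = 1))) (decide (trans (2 * k) (n - 2 * k) P b x = 1)) := by
  funext b
  unfold symK
  rw [sig_eq_bind, sig_eq_bind, sig_eq_bind, bx_bind, bx_bind, decide_bind_eq_one]

/-- Ring-game helper `symK_perfect` (lens-2 law package; see the module docstring). -/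
theorem symK_perfect {k : ℕ} (hk : 2 * k ≤ n) {P : Fin n → CubeFn (ZMod 3) n}
    (hperf : ∀ x : Fin n → Bool, OddZeros x → RingHLF.Rel x (fun b => decide (P b x = 1))) :
    ∀ x : Fin n → Bool, OddZeros x → RingHLF.Rel x (fun b => decide (symK k P b x = 1)) := by
  intro x hx
  rw [symK_out]
  exact rel_xor3 (hperf x hx) (perfect_trans ⟨1, by omega⟩ P hperf x hx) (perfect_trans ⟨1, by omega⟩ P hperf x hx)

/-- the notch LOWERS the symmetry modulus by a factor three: a `3k`-equivariant strategy becomes `k`-equivariant. -/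
theorem symK_equivariant {k : ℕ} (hk : 2 * k ≤ n) (P : Fin n → CubeFn (ZMod 3) n) (hE : P ∈ equivariant (3 * k) n) :
    symK k P ∈ equivariant k n := by
  rw [mem_equivariant] at hE ⊢
  intro b x
  have e1 : RingSymmetry.shift n k (RingSymmetry.shift n k b) = RingSymmetry.shift n (2 * k) b := by
    rw [RingSymmetry.shift_shift, ← two_mul]
  have e2 : RingSymmetry.shift n (2 * k) (RingSymmetry.shift n k b) = RingSymmetry.shift n (3 * k) b := by
    rw [RingSymmetry.shift_shift, show k + 2 * k = 3 * k by ring]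
  have e3 : rot (n - k) (rot k x) = x := by
    rw [RingSymmetry.rot_rot, show n - k + k = n by omega, rot_n]
  have e4 : rot (n - 2 * k) (rot k x) = rot (n - k) x := by
    rw [RingSymmetry.rot_rot, show n - 2 * k + k = n - k by omega]
  have e6 : rot (3 * k) (rot (n - 2 * k) x) = rot k x := by
    rw [RingSymmetry.rot_rot, show 3 * k + (n - 2 * k) = k + n by omega, ← RingSymmetry.rot_rot, rot_n]
  simp only [symK, trans, bx, sig, Pi.add_apply, Pi.mul_apply, Pi.smul_apply, Pi.one_apply, smul_eq_mul, e1, e2, e3, e4, hE, e6]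
  ring

/-- every strategy is (trivially) `n`-equivariant on `C_n`. -/
theorem eqv_self (P : Fin n → CubeFn (ZMod 3) n) : P ∈ equivariant n n := by
  rw [mem_equivariant]
  intro b x
  rw [shift_n, rot_n]

/-- **THE TOWER**: a perfect `3ⁱk`-equivariant strategy of degree `≤ D` (with `3ⁱk ≤ n`) yields a perfect `k`-EQUIVARIANT strategy of
degree `≤ 6ⁱ·D` on the same ring. -/
theorem tower : ∀ (i k D : ℕ) (P : Fin n → CubeFn (ZMod 3) n), 3 ^ i * k ≤ n → (∀ b, P b ∈ lowDeg (ZMod 3) n D) →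
    P ∈ equivariant (3 ^ i * k) n → (∀ x : Fin n → Bool, OddZeros x → RingHLF.Rel x (fun b => decide (P b x = 1))) →
    ∃ S : Fin n → CubeFn (ZMod 3) n, (∀ b, S b ∈ lowDeg (ZMod 3) n (6 ^ i * D)) ∧ S ∈ equivariant k n ∧
      (∀ x : Fin n → Bool, OddZeros x → RingHLF.Rel x (fun b => decide (S b x = 1)))
  | 0, k, D, P, _, hP, hE, hperf => ⟨P, by simpa using hP, by simpa using hE, hperf⟩
  | i + 1, k, D, P, hk, hP, hE, hperf => by
    have h3 : 3 * k ≤ 3 ^ (i + 1) * k := Nat.mul_le_mul_right k (by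
      calc (3 : ℕ) = 3 ^ 1 := by norm_num
        _ ≤ 3 ^ (i + 1) := Nat.pow_le_pow_right (by norm_num) (by omega))
    obtain ⟨S', hS', hE', hperf'⟩ := tower i (3 * k) D P (by rw [show 3 ^ i * (3 * k) = 3 ^ (i + 1) * k by ring]; exact hk) hP
      (by rw [show 3 ^ i * (3 * k) = 3 ^ (i + 1) * k by ring]; exact hE) hperf
    refine ⟨symK k S', fun b => ?_, symK_equivariant (by omega) S' hE', symK_perfect (by omega) hperf'⟩
    have := symK_mem hS' k b
    rwa [show 6 * (6 ^ i * D) = 6 ^ (i + 1) * D by ring] at this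

/-- **THE SYMMETRY DIAL (EQUIV at every constant notch)**: for each fixed `j`, «every `losing d` is co-finite» (= `ExactnessDial.NoPerfectConst3`
verbatim) iff every constant-degree `ℤ/3ʲ`-SYMMETRIC strategy (commuting with rotation by `m`) on the rings `C_{3ʲm}` loses on some odd-class
pattern — tower (degree `6ʲ·d`) + residue-class equivalence (`q = 3ʲ`). -/
theorem allHard_iff_eqv (j : ℕ) :
    (∀ d : ℕ, ∃ n₀ : ℕ, ∀ n ≥ n₀, n ∈ losing d) ↔
    (∀ d : ℕ, ∃ m₀ : ℕ, ∀ m ≥ m₀, ∀ P : Fin (3 ^ j * m) → CubeFn (ZMod 3) (3 ^ j * m), (∀ b, P b ∈ lowDeg (ZMod 3) (3 ^ j * m) d) →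
      P ∈ equivariant m (3 ^ j * m) → ∃ x : Fin (3 ^ j * m) → Bool, OddZeros x ∧ ¬ RingHLF.Rel x (fun b => decide (P b x = 1))) := by
  constructor
  · intro hT d
    obtain ⟨n₀, h⟩ := hT d
    refine ⟨n₀, fun m hm P hP _ => (mem_losing d _).1 (h (3 ^ j * m) ?_) P hP⟩
    exact le_trans hm (Nat.le_mul_of_pos_left m (Nat.one_le_pow _ _ (by norm_num)))
  · intro H
    rw [allHard_iff_class (q := 3 ^ j) (Nat.one_le_pow _ _ (by norm_num)) 0]
    intro d
    obtain ⟨m₀, h⟩ := H (6 ^ j * d)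
    refine ⟨3 ^ j * m₀ + 2, fun n hn hmod => ?_⟩
    obtain ⟨m, rfl⟩ : ∃ m, n = 3 ^ j * m :=
      ⟨n / 3 ^ j, (Nat.mul_div_cancel' (Nat.dvd_of_mod_eq_zero (by simpa using hmod))).symm⟩
    have hm : m₀ ≤ m := by
      by_contra hlt
      push Not at hlt
      have : 3 ^ j * m ≤ 3 ^ j * m₀ := Nat.mul_le_mul_left _ hlt.le
      omega
    rw [mem_losing]
    intro P hP
    by_contra hcon
    push Not at hcon
    obtain ⟨S, hS, hE, hperf⟩ := tower j m d P le_rfl hP (eqv_self P) hcon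
    obtain ⟨x, hx, hnx⟩ := h m hm S hS hE
    exact hnx (hperf x hx)

end deck

end Summit.QuantumAdvantage.QuantumAdvantage.Theorems.RingMinor
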